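import Literature.AlgebraicGeometry.HodgeTheory.WeilClassesFieldDecomposableOfSymmetric
import Literature.AlgebraicGeometry.HodgeTheory.WeilClassesFieldExceptionalOfNotMemAdjoin
import Literature.AlgebraicGeometry.HodgeTheory.WeilClassesFieldIntersections
import Literature.AlgebraicGeometry.HodgeTheory.AbelianLowDimensionWeilReductionProofs
import Literature.AlgebraicGeometry.HodgeTheory.LefschetzOneOneHolds
import Literature.AlgebraicGeometry.HodgeTheory.DivisorLefschetzGroupLargest
import Literature.AlgebraicGeometry.ComplexMultiplication.RosatiPolarizationCM
import HarnessLib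

/-!
# Criterion (2) for abelian varieties with COMMUTATIVE divisor algebra `B`: the complete dichotomy
# «`W_F` decomposable ⟺ `F ⊆ B` ⟺ `F` pointwise Rosati-fixed; otherwise all non-zero Weil classes exceptional» —
# and, for a simple CM abelian variety, «`W_{ℚ(a)}` decomposable ⟺ `ā = a`» (Moonen–Zarhin 1998 §1, the rows
# «Type 3, `m = 1`, `F ⊄ E`», «Type 4, `d = 1`, `m = 1`, `F ⊄ E₀`» and type 1 with `m = 1`, PROVED on the carrier)

Layer `Literature/AlgebraicGeometry/HodgeTheory`; THEOREMS ONLY — no definition, no named fact, sorry-free (D-0026,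
net debt 0). Junction of the seat's g17-#3 `WeilClassesFieldDecomposableOfSymmetric` («`φ^*` `Q_h`-symmetric ⟹ `W_F`
decomposable», outright) with g17-#6 `WeilClassesFieldExceptionalOfNotMemAdjoin` («`φ^* ∉ B ⊗ ℂ` ⟹ all non-zero Weil
classes exceptional», outright), closed into an EQUIVALENCE by one observation: when the algebra `B ⊗ ℂ` generated by the
`†`-symmetric elements is COMMUTATIVE, every element of `B ⊗ ℂ` is itself `†`-symmetric (`B = S_λ`), so «`F ⊆ B`» and
«`F` pointwise Rosati-fixed» coincide — and by the print's Table 1 (`B = E`, `E`, `E₀` in the rows type 1 with `m = 1`,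
type 3 with `m = 1`, type 4 with `d = m = 1`) this is exactly the part of Criterion (2) where `B` is a number field.

## The print

B. J. J. Moonen, Yu. G. Zarhin, *Weil classes on abelian varieties*, J. reine angew. Math. **496** (1998) =
arXiv:alg-geom/9612017 [MoonenZarhin1998WeilClasses] (held text `paper:arxiv-alg-geom_9612017`), §1: chunk p0002
L54–L58 «Let `S_λ ⊆ End⁰(X)` be the set of `†`-symmetric elements. We define the algebra `B ⊆ End⁰(X)` as the
`ℚ`-subalgebra generated by `S_λ`.»; chunk p0002 L59–L60 «For all possible types in the Albert classification one can
determine the algebra `B` and its center `K_B`. The results are listed in Table 1.»; Criterion (2) (chunk p0003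
L46–L58, VERBATIM) «Suppose `X` is isogenous to a power `Y^m` of a simple abelian variety `Y` […] Suppose
`F ↪ End⁰(X)` is a subfield such that `W_F = ⋀^r V_X` consists of Hodge classes […]. Then either all classes in `W_F`
are decomposable, or all non-zero classes in `W_F` are exceptional; this last possibility occurs precisely in the
following cases: `Y` is of Type 3, `m = 1` and `F ⊄ E`, […] `Y` is of Type 4, `d = 1`, `m = 1` and `F ⊄ E₀`, […]»;
its proof (chunk p0003 L62–L70) «First assume that `X` is either of type 1, 2 or of type 3 with `m = 1`, or that `X` is
of type 4 with `d = 1` and `m = 1`. We claim that, in these cases, `G_div(X)` acts as the identity on `W_F` if and only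
if `F ⊆ B`. […]».

## The carrier (as in g13-#6 / g14-#3 / g16-#1 / g17-#3: `ℂ`-points, read on `H¹(A(ℂ); ℂ)`)

`V ⊗ ℂ = H¹(A(ℂ); ℂ)`; `Q_h` the polarization pairing of a class `h` (`Motives.polarizationPairingOne`, top-line valued);
the Rosati involution `†` = the `Q_h`-adjoint, read as the RELATION «`T` is `Q_h`-symmetric», `Q_h(T x, y) = Q_h(x, T y)`;
`S_λ ⊗ ℂ = symmetricPullbackSpan A h`; `B ⊗ ℂ = Algebra.adjoin ℂ (S_λ ⊗ ℂ)`; `End⁰(X) ⊗ ℂ` = the span of the pull-backs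
`φ^*` (= Milne's bicommutant `E''`, `Milne1999.mem_bicommutant_iff_mem_span`); `G_div(X)(ℂ) = divisorLefschetzGroup A h`;
`F = ℚ(φ)`, `P(φ) = 0` (`P ∈ ℤ[T]` monic irreducible of degree `e`), `e · 2m = 2 dim A`; `W_F ⊗ ℂ = weilClassesField A φ P (2m)`;
`𝒟ᵐ ⊗ ℂ = divisorClassesSpan A.X (dim A) m`. «`B` COMMUTATIVE» is entered as its generating condition on the carrier:
the elements of `S_λ ⊗ ℂ` COMMUTE PAIRWISE (equivalently, §1: `S_λ ⊗ ℂ` is closed under products; `B ⊗ ℂ = S_λ ⊗ ℂ`).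

## What is proved

* §1 «`B = S_λ`» FOR COMMUTATIVE `B`: **`polarizationPairingOne_apply_eq_of_mem_adjoin_of_comm`** — if `S_λ ⊗ ℂ` is
  pairwise commuting, every `T ∈ B ⊗ ℂ` is `Q_h`-symmetric (a product of COMMUTING symmetric elements is symmetric);
  **`coe_adjoin_symmetricPullbackSpan_eq_of_comm`** — then `B ⊗ ℂ = S_λ ⊗ ℂ`; conversely
  **`mul_comm_of_mul_mem_symmetricPullbackSpan`** (`Q_h` non-degenerate) — a symmetric product of symmetric elements
  commutes, so **`forall_mul_mem_symmetricPullbackSpan_iff_forall_comm`**: `S_λ ⊗ ℂ` is an algebra iff it is commutative;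
  and the source of commutativity on the carrier, **`symmetricPullbackSpan_comm_of_forall_comp_comm`**: `End(A)`
  commutative (`f ≫ g = g ≫ f`) ⟹ `End⁰(X) ⊗ ℂ` commutative ⟹ `S_λ ⊗ ℂ` pairwise commuting.
* §2 «`G_div(X) ⊆ Sl_F(V_X)`» for commutative `B` and EVERY `F ⊆ B`:
  **`detOnEigenspace_eq_one_of_mem_divisorLefschetzGroup_of_comm`** (g17-#3's symplectic-isometry determinant).
* §3 THE DICHOTOMY for commutative `B` (`0 < dim A`; `h` rational with a Kähler multiple `t • h`, `t ∈ ℝ ∖ 0` — every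
  polarization class; `P`, `φ`, `e`, `m` as above): **`weilClassesField_le_divisorClassesSpan_iff_mem_adjoin_of_comm`**
  (`W_F` decomposable ⟺ `φ^* ∈ B ⊗ ℂ`, «if and only if `F ⊆ B`» — the `Sl_F` half being automatic),
  **`weilClassesField_le_divisorClassesSpan_iff_symm_of_comm`** (⟺ `φ^*` is `Q_h`-symmetric, i.e. `φ† = φ`),
  **`weilClassesField_inf_divisorClassesSpan_eq_bot_iff_not_symm_of_comm`** (`m ≠ 0`: ALL NON-ZERO WEIL CLASSES
  EXCEPTIONAL ⟺ `φ† ≠ φ`), the outright halves `…_of_mem_adjoin_of_comm` / `…_le_algebraicClasses_of_symm_of_comm`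
  (decomposable ⟹ ALGEBRAIC, Lefschetz `(1,1)` of the tree) / `…_eq_bot_of_ne_of_comm`, in the `B¹ ⊗ ℂ` spelling where
  positivity is not needed.
* §4 `End(A)` COMMUTATIVE (e.g. `End⁰(A)` a field): **`weilClassesField_le_divisorClassesSpan_iff_symm_of_forall_comp_comm`**,
  **`weilClassesField_inf_divisorClassesSpan_eq_bot_iff_not_symm_of_forall_comp_comm`** — for EVERY subfield
  `F = ℚ(φ) ⊆ End⁰(A)`: `W_F` decomposable ⟺ `φ` Rosati-symmetric; all non-zero classes of `W_F` exceptional ⟺ not.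
* §5 THE CM ROW, PROVED: **`weilClassesField_le_divisorClassesSpan_iff_conj_eq_of_isCMTypeRealisation`** and
  **`weilClassesField_inf_divisorClassesSpan_eq_bot_iff_conj_ne_of_isCMTypeRealisation`** — for a realisation `(A, ι, θ)`
  of a CM type `(K; Φ)` (`ComplexMultiplication.IsCMTypeRealisation`) with `End(A)` commutative (for a CM-type
  realisation by the FIELD `K` this is `A` SIMPLE, `End⁰(A) = K` — my gloss, not used) and `a ∈ 𝓞_K` with `P(ι a) = 0`,
  `e · 2m = 2 dim A`, `m ≠ 0`: `W_{ℚ(a)} ⊗ ℂ ≤ 𝒟ᵐ ⊗ ℂ ⟺ ā = a`, and `W_{ℚ(a)} ⊗ ℂ ⊓ 𝒟ᵐ ⊗ ℂ = ⊥ ⟺ ā ≠ a` — «`Y` of Type 4,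
  `d = 1`, `m = 1`: all non-zero classes in `W_F` are exceptional precisely when `F ⊄ E₀`» with `E = K`, `E₀ = K⁺`,
  through Shimura's Rosati formula `ι(a)† = ι(ā)` of the tree (`IsCMTypeRealisation.exists_rosati_kaehlerClass`).
* §6 (rider) THE STANDARD-INVOLUTION HYPOTHESIS «`x + x†` central» (the canonical involution of a totally definite
  quaternion algebra — the Rosati involution of type III, `m = 1`; trivially any commutative `End⁰(X)`):
  **`symmetricPullbackSpan_comm_pullbackOne_of_forall_add_adjoint`** (`S_λ ⊗ ℂ` is CENTRAL: a symmetric `s` is its own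
  adjoint, so `2s` is central), `symmetricPullbackSpan_comm_of_forall_add_adjoint` (⟹ the commutativity hypothesis of
  §§1–4: «`B = E`»), **`weilClassesField_inf_divisorClassesSpan_eq_bot_of_not_comm_of_forall_add_adjoint`** — «`Y` of
  Type 3, `m = 1` and `F ⊄ E` ⟹ all non-zero classes in `W_F` exceptional» READ ON THE CARRIER: `φ^*` not commuting with
  some pull-back ⟹ `W_F ⊗ ℂ ⊓ 𝒟ᵐ ⊗ ℂ = ⊥` — and `weilClassesField_le_divisorClassesSpan_iff_symm_of_forall_add_adjoint`.

Scope (said once, precisely): carrier statements for EVERY complex abelian variety with pairwise-commuting `S_λ ⊗ ℂ`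
(resp. commutative `End(A)`, resp. a CM-type realisation with commutative `End(A)`, resp. the standard-involution hypothesis), every polarization
class; no Albert type is read off, no simplicity is used; the identification of the hypothesis with the print's rows (Table 1: `B` is a
field exactly in type 1 with `m = 1`, type 3 with `m = 1`, type 4 with `d = m = 1`) is the print's, quoted, NOT
formalised. NOT here: non-commutative `B` (types 1–2 with `m ≥ 2` or `D ≠ E`, type 3 with `m ≥ 2`: parity; type 4 with
`d ≥ 2` or `m ≥ 2`: the `θ`-criterion — mechanisms in the seat's g13-#5 / g14-#3 / g18-#1), Tate classes (§3).

## References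

* [MoonenZarhin1998WeilClasses] B. J. J. Moonen, Yu. G. Zarhin, J. reine angew. Math. 496 (1998) =
  arXiv:alg-geom/9612017, §1: `S_λ`, `B`, Table 1 (chunk p0002 L54–L62), `G_div(X)` (chunk p0002 L64–L76), Lemma (3)
  (chunk p0003 L4–L12), Criterion (2) and its proof (chunk p0003 L46–L70), «all or nothing» (chunk p0001 L57–L66).
* [Milne1999LefschetzClasses] J. S. Milne, Duke Math. J. 96 (1999), §1 Remark 1.2, p. 645 («every Rosati involution
  […] acts on [each factor of `C₀(A)`] as complex conjugation»), Thm. 3.2, Cor. 4.5.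
* [Shimura1998] G. Shimura, Abelian Varieties with Complex Multiplication and Modular Functions (PUP 1998), §6.2
  Theorem 4 (3) (the Rosati involution of a CM abelian variety induces complex conjugation).
* [LangeBirkenhake1992] H. Lange, Ch. Birkenhake, Complex Abelian Varieties (1992), §5.1 (Rosati = adjoint),
  Thm. 5.5.6 (the Rosati involution by Albert type; type III: the canonical involution).
* [MumfordAV1970] D. Mumford, Abelian Varieties (1970), §21 Thm. 2 (positive involutions of the four types).
* [McDuffSalamon2017] D. McDuff, D. Salamon, Introduction to Symplectic Topology, 3rd ed. (OUP 2017), Lemma 1.1.15.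
* [VoisinHodgeI2002] C. Voisin, Hodge Theory and Complex Algebraic Geometry I (CUP 2002), Thm. 11.30.

## Provenance

Lane `lit-hodgefound` (Track 2, Layer A), prover seat `lit-hodgefound-p21` (generation 18), row g18-#2: successor note
(c) of generation 17 («identification of `B` by Albert type (Table 1: `B = E` for type 3 `m = 1`, `B = E₀` for type 4
`d = m = 1`)») rendered classification-free — «`B` commutative» — and carried to the CM row of Criterion (2).
-/

noncomputable section

open CategoryTheory Polynomial Module NumberField

namespace Literature.AlgebraicGeometry.HodgeTheory

open Literature.AlgebraicGeometry.Motives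
open Literature.AlgebraicGeometry.VanGeemen1994 (hodgeClassSpan pullbackOne detOnEigenspace)
open Literature.AlgebraicGeometry.Milne1999 (unitaryCentralizerGroup centralizerAlgebra mem_bicommutant_iff_mem_span
  mem_hodgeClassSpan_one_of_isKaehlerClass_smul eq_zero_of_forall_polarizationPairingOne_eq_zero_of_isKaehlerClass_smul')
open Literature.AlgebraicTopology.SingularHomology
open Literature.Barriers.HodgeConjecture (divisorClassesSpan)

section HodgeTheory

variable {A : AbelianVariety ℂ} {h : complexBetti A.X 2} {φ : A ⟶ A} {P : Polynomial ℤ} {e m : ℕ} {t : ℝ}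
  {u : complexBetti A.X 1 ≃ₗ[ℂ] complexBetti A.X 1} {S T : Module.End ℂ (complexBetti A.X 1)}

/-! ### §1 «`B = S_λ`» when `B` is commutative -/

/-- Pairwise commutation of `S_λ ⊗ ℂ` propagates to the algebra `B ⊗ ℂ = Algebra.adjoin ℂ (S_λ ⊗ ℂ)` it generates.
[cite: MoonenZarhin1998WeilClasses, §1 (definition of B; chunk p0002 L54–L58)] -/
theorem adjoin_symmetricPullbackSpan_comm_of_comm
    (hS : ∀ S ∈ symmetricPullbackSpan A h, ∀ T ∈ symmetricPullbackSpan A h, S * T = T * S)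
    (hSB : S ∈ Algebra.adjoin ℂ (symmetricPullbackSpan A h : Set (Module.End ℂ (complexBetti A.X 1))))
    (hTB : T ∈ Algebra.adjoin ℂ (symmetricPullbackSpan A h : Set (Module.End ℂ (complexBetti A.X 1)))) :
    S * T = T * S :=
  Set.centralizer_centralizer_comm_of_comm hS _ (Algebra.adjoin_le_centralizer_centralizer ℂ _ hSB) _
    (Algebra.adjoin_le_centralizer_centralizer ℂ _ hTB)

/-- **For commutative `B`, every element of `B ⊗ ℂ` is `†`-symmetric**: if the elements of `S_λ ⊗ ℂ` commute pairwise,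
every `T ∈ B ⊗ ℂ = Algebra.adjoin ℂ (S_λ ⊗ ℂ)` satisfies `Q_h(T x, y) = Q_h(x, T y)` (generators are symmetric; a product
`S T` of symmetric elements has adjoint `T S`, which is `S T` in a commutative `B ⊗ ℂ`). This is the carrier form of the
rows of Table 1 in which `B` is a field (`B = E`, `E`, `E₀`). [cite: MoonenZarhin1998WeilClasses, §1 (S_λ, B, Table 1; chunk p0002 L54–L62)]
[cite: LangeBirkenhake1992, §5.1] -/
theorem polarizationPairingOne_apply_eq_of_mem_adjoin_of_comm
    (hS : ∀ S ∈ symmetricPullbackSpan A h, ∀ T ∈ symmetricPullbackSpan A h, S * T = T * S)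
    (hT : T ∈ Algebra.adjoin ℂ (symmetricPullbackSpan A h : Set (Module.End ℂ (complexBetti A.X 1))))
    (x y : complexBetti A.X 1) :
    polarizationPairingOne A.X h (A.dim - 1) (T x) y = polarizationPairingOne A.X h (A.dim - 1) x (T y) := by
  induction hT using Algebra.adjoin_induction generalizing x y with
  | mem S hS0 => exact hS0.2 x y
  | algebraMap r =>
    rw [Algebra.algebraMap_eq_smul_one, LinearMap.smul_apply, LinearMap.smul_apply, Module.End.one_apply,
      Module.End.one_apply, map_smul, LinearMap.smul_apply, map_smul]
  | add S S' _ _ hS1 hS2 => rw [LinearMap.add_apply, LinearMap.add_apply, map_add, LinearMap.add_apply, map_add, hS1, hS2]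
  | mul S S' hSB hS'B hS1 hS2 =>
    have hc : S' (S y) = S (S' y) := by
      rw [← Module.End.mul_apply, adjoin_symmetricPullbackSpan_comm_of_comm hS hS'B hSB, Module.End.mul_apply]
    rw [Module.End.mul_apply, Module.End.mul_apply, hS1, hS2, hc]

/-- **`B ⊗ ℂ ⊆ S_λ ⊗ ℂ` for commutative `B`** (so `B = S_λ`): every element of `Algebra.adjoin ℂ (S_λ ⊗ ℂ)` is a symmetric
`ℂ`-combination of pull-backs (it lies in the span of the pull-backs, a subalgebra — Milne's bicommutant `E''`,
`Milne1999.mem_bicommutant_iff_mem_span` — and is symmetric by the previous theorem).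
[cite: MoonenZarhin1998WeilClasses, §1 (chunk p0002 L54–L62)] [cite: Milne1999LefschetzClasses, §1 Remark 1.2 (p. 643)] -/
theorem mem_symmetricPullbackSpan_of_mem_adjoin_of_comm
    (hS : ∀ S ∈ symmetricPullbackSpan A h, ∀ T ∈ symmetricPullbackSpan A h, S * T = T * S)
    (hT : T ∈ Algebra.adjoin ℂ (symmetricPullbackSpan A h : Set (Module.End ℂ (complexBetti A.X 1)))) :
    T ∈ symmetricPullbackSpan A h := by
  refine ⟨mem_bicommutant_iff_mem_span.1 (Algebra.adjoin_le (S := Subalgebra.centralizer ℂ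
    (centralizerAlgebra A : Set (Module.End ℂ (complexBetti A.X 1)))) (fun S hS0 ↦ ?_) hT),
    polarizationPairingOne_apply_eq_of_mem_adjoin_of_comm hS hT⟩
  exact mem_bicommutant_iff_mem_span.2 (symmetricPullbackSpan_le_span hS0)

/-- **`B ⊗ ℂ = S_λ ⊗ ℂ` for commutative `B`** (as subsets of `End(H¹(A(ℂ); ℂ))`).
[cite: MoonenZarhin1998WeilClasses, §1 (chunk p0002 L54–L62)] -/
theorem coe_adjoin_symmetricPullbackSpan_eq_of_comm
    (hS : ∀ S ∈ symmetricPullbackSpan A h, ∀ T ∈ symmetricPullbackSpan A h, S * T = T * S) :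
    (Algebra.adjoin ℂ (symmetricPullbackSpan A h : Set (Module.End ℂ (complexBetti A.X 1))) :
        Set (Module.End ℂ (complexBetti A.X 1))) = symmetricPullbackSpan A h :=
  Set.Subset.antisymm (fun _ hT ↦ mem_symmetricPullbackSpan_of_mem_adjoin_of_comm hS hT) Algebra.subset_adjoin

/-- **Commuting symmetric elements have a symmetric product** (`(S T)† = T† S† = T S = S T`), which lies in `S_λ ⊗ ℂ`.
[cite: MoonenZarhin1998WeilClasses, §1 (chunk p0002 L54–L58)] [cite: LangeBirkenhake1992, §5.1] -/
theorem mul_mem_symmetricPullbackSpan_of_comm (hS0 : S ∈ symmetricPullbackSpan A h)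
    (hT0 : T ∈ symmetricPullbackSpan A h) (hST : S * T = T * S) : S * T ∈ symmetricPullbackSpan A h := by
  refine ⟨mem_bicommutant_iff_mem_span.1 (Subalgebra.mul_mem _ (mem_bicommutant_iff_mem_span.2 hS0.1)
    (mem_bicommutant_iff_mem_span.2 hT0.1)), fun x y ↦ ?_⟩
  conv_rhs => rw [hST]
  rw [Module.End.mul_apply, Module.End.mul_apply, hS0.2, hT0.2]

/-- **A symmetric product of symmetric elements is a commuting product** (`Q_h` non-degenerate): if `S`, `T` and `S T`
all lie in `S_λ ⊗ ℂ` then `S T = T S` — `Q_h(x, S T y) = Q_h(S T x, y) = Q_h(x, T S y)` for all `x, y`.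
[cite: MoonenZarhin1998WeilClasses, §1 (chunk p0002 L54–L58)] [cite: LangeBirkenhake1992, §5.1] -/
theorem mul_comm_of_mul_mem_symmetricPullbackSpan
    (hnd : ∀ x : complexBetti A.X 1, (∀ y, polarizationPairingOne A.X h (A.dim - 1) x y = 0) → x = 0)
    (hS0 : S ∈ symmetricPullbackSpan A h) (hT0 : T ∈ symmetricPullbackSpan A h)
    (hST : S * T ∈ symmetricPullbackSpan A h) : S * T = T * S := by
  refine LinearMap.ext fun y ↦ ?_
  rw [← sub_eq_zero, ← LinearMap.sub_apply]
  refine hnd _ fun x ↦ ?_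
  -- `Q_h((S T - T S) y, x) = Q_h(y, S T x) - Q_h(y, S T x) = 0`
  rw [LinearMap.sub_apply, map_sub, LinearMap.sub_apply, hST.2, Module.End.mul_apply, Module.End.mul_apply, hT0.2,
    hS0.2, sub_self]

/-- **`S_λ ⊗ ℂ` is closed under products iff it is commutative** (`Q_h` non-degenerate) — i.e. `B = S_λ` iff `B` is
commutative. [cite: MoonenZarhin1998WeilClasses, §1 (S_λ, B; chunk p0002 L54–L62)] -/
theorem forall_mul_mem_symmetricPullbackSpan_iff_forall_comm
    (hnd : ∀ x : complexBetti A.X 1, (∀ y, polarizationPairingOne A.X h (A.dim - 1) x y = 0) → x = 0) :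
    (∀ S ∈ symmetricPullbackSpan A h, ∀ T ∈ symmetricPullbackSpan A h, S * T ∈ symmetricPullbackSpan A h) ↔
      ∀ S ∈ symmetricPullbackSpan A h, ∀ T ∈ symmetricPullbackSpan A h, S * T = T * S :=
  ⟨fun H S hS0 T hT0 ↦ mul_comm_of_mul_mem_symmetricPullbackSpan hnd hS0 hT0 (H S hS0 T hT0),
    fun H S hS0 T hT0 ↦ mul_mem_symmetricPullbackSpan_of_comm hS0 hT0 (H S hS0 T hT0)⟩

/-- `(f ≫ g)^* = f^* ∘ g^*` on `H¹`, in `Module.End` (contravariance; restated as in the seat's g17-#5). [folklore] -/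
private theorem pullbackOne_comp' (f g : A ⟶ A) : pullbackOne A (f ≫ g) = pullbackOne A f * pullbackOne A g := by
  change (complexBetti.map (f.hom.hom.hom ≫ g.hom.hom.hom) 1).hom = _
  rw [complexBetti.map_comp, ModuleCat.hom_comp]
  rfl

/-- Pairwise commuting pull-backs have a pairwise commuting span. [folklore] -/
private theorem span_pullbackOne_comm
    (hc : ∀ f g : A ⟶ A, pullbackOne A f * pullbackOne A g = pullbackOne A g * pullbackOne A f)
    (hS0 : S ∈ Submodule.span ℂ (Set.range fun φ : A ⟶ A ↦ pullbackOne A φ))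
    (hT0 : T ∈ Submodule.span ℂ (Set.range fun φ : A ⟶ A ↦ pullbackOne A φ)) : S * T = T * S := by
  induction hT0 using Submodule.span_induction with
  | mem T hT =>
    obtain ⟨g, rfl⟩ := hT
    induction hS0 using Submodule.span_induction with
    | mem S hS =>
      obtain ⟨f, rfl⟩ := hS
      exact hc f g
    | zero => rw [zero_mul, mul_zero]
    | add S S' _ _ h1 h2 => rw [add_mul, mul_add, h1, h2]
    | smul r S _ h1 => rw [smul_mul_assoc, mul_smul_comm, h1]
  | zero => rw [zero_mul, mul_zero]
  | add T T' _ _ h1 h2 => rw [add_mul, mul_add, h1, h2]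
  | smul r T _ h1 => rw [smul_mul_assoc, mul_smul_comm, h1]

/-- **`End(A)` commutative ⟹ `S_λ ⊗ ℂ` pairwise commuting** (`End⁰(X) ⊗ ℂ`, the span of the pull-backs, is then
commutative, and `S_λ ⊗ ℂ` lies inside it): the source, on the carrier, of a commutative `B` — e.g. `End⁰(X) = E` a
totally real field (type 1, `m = 1`) or a CM field (type 4, `d = m = 1`).
[cite: MoonenZarhin1998WeilClasses, §1 (chunk p0002 L54–L62)] -/
theorem symmetricPullbackSpan_comm_of_forall_comp_comm (hE : ∀ f g : A ⟶ A, f ≫ g = g ≫ f) :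
    ∀ S ∈ symmetricPullbackSpan A h, ∀ T ∈ symmetricPullbackSpan A h, S * T = T * S :=
  fun _ hS0 _ hT0 ↦ span_pullbackOne_comm
    (fun f g ↦ by rw [← pullbackOne_comp', hE f g, pullbackOne_comp']) hS0.1 hT0.1

/-! ### §2 «`G_div(X) ⊆ Sl_F(V_X)`» for commutative `B` and every `F ⊆ B` -/

/-- **For commutative `B` and `φ^* ∈ B ⊗ ℂ`, every `u ∈ G_div(X)(ℂ)` has `det(u | V^{(τ)}) = 1` on every eigenspace of
`φ^*`** (`0 < dim A`, `P(φ) = 0` with `P` irreducible, `Q_h` non-degenerate): `φ^*` is `Q_h`-symmetric (§1), and the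
seat's g17-#3 `detOnEigenspace_eq_one_of_mem_divisorLefschetzGroup_of_symm` applies — the print's «in these cases
`G_div(X) ⊆ Sl_F(V_X)`» for the rows with `B` a field, without «connected and semi-simple».
[cite: MoonenZarhin1998WeilClasses, §1 proof of Criterion (2) (chunk p0003 L62–L70)] [cite: McDuffSalamon2017, Lemma 1.1.15] -/
theorem detOnEigenspace_eq_one_of_mem_divisorLefschetzGroup_of_comm (hA : 0 < A.dim)
    (hPirr : Irreducible (P.map (Int.castRingHom ℚ)))
    (hφ : Polynomial.eval₂ (Int.castRingHom (CategoryTheory.End A)) (φ : CategoryTheory.End A) P = 0)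
    (hnd : ∀ x : complexBetti A.X 1, (∀ y, polarizationPairingOne A.X h (A.dim - 1) x y = 0) → x = 0)
    (hS : ∀ S ∈ symmetricPullbackSpan A h, ∀ T ∈ symmetricPullbackSpan A h, S * T = T * S)
    (hF : pullbackOne A φ ∈ Algebra.adjoin ℂ (symmetricPullbackSpan A h : Set (Module.End ℂ (complexBetti A.X 1))))
    (hu : u ∈ divisorLefschetzGroup A h) (τ : ℂ) :
    detOnEigenspace u (pullbackOne A φ)
      (comm_pullbackOne_of_mem_divisorLefschetzGroup_of_pullbackOne_mem_adjoin hF hu) τ = 1 :=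
  detOnEigenspace_eq_one_of_mem_divisorLefschetzGroup_of_symm hA hPirr hφ hnd
    (polarizationPairingOne_apply_eq_of_mem_adjoin_of_comm hS hF) hu τ

/-! ### §3 The dichotomy for commutative `B` -/

/-- **`F ⊆ B` ⟹ `W_F` DECOMPOSABLE, for commutative `B`** (`0 < dim A`; `P` monic irreducible of degree `e`, `P(φ) = 0`,
`e · 2m = 2 dim A`; `h ∈ B¹(A) ⊗ ℂ` with `Q_h` non-degenerate): `W_F ⊗ ℂ ≤ 𝒟ᵐ ⊗ ℂ` (§1 + the seat's g17-#3
`weilClassesField_le_divisorClassesSpan_of_symm`). [cite: MoonenZarhin1998WeilClasses, §1 Criterion (2) and its proof (chunk p0003 L46–L70)] -/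
theorem weilClassesField_le_divisorClassesSpan_of_mem_adjoin_of_comm (hA : 0 < A.dim)
    (hPm : P.Monic) (hPe : P.natDegree = e) (hPirr : Irreducible (P.map (Int.castRingHom ℚ)))
    (hφ : Polynomial.eval₂ (Int.castRingHom (CategoryTheory.End A)) (φ : CategoryTheory.End A) P = 0)
    (her : e * (2 * m) = 2 * A.dim) (hh : h ∈ hodgeClassSpan A.dim A.X 1)
    (hnd : ∀ x : complexBetti A.X 1, (∀ y, polarizationPairingOne A.X h (A.dim - 1) x y = 0) → x = 0)
    (hS : ∀ S ∈ symmetricPullbackSpan A h, ∀ T ∈ symmetricPullbackSpan A h, S * T = T * S)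
    (hF : pullbackOne A φ ∈ Algebra.adjoin ℂ (symmetricPullbackSpan A h : Set (Module.End ℂ (complexBetti A.X 1)))) :
    weilClassesField A φ P (2 * m) ≤ divisorClassesSpan A.X A.dim m :=
  weilClassesField_le_divisorClassesSpan_of_symm hA hPm hPe hPirr hφ her hh hnd
    (polarizationPairingOne_apply_eq_of_mem_adjoin_of_comm hS hF)

/-- **… and ALGEBRAIC**: `W_F ⊗ ℂ ≤ algebraicClasses A.X m` («the decomposable classes are algebraic», the tree's
Lefschetz `(1,1)` theorem through `AbelianVariety.divisorClassesSpan_le_algebraicClasses`).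
[cite: MoonenZarhin1998WeilClasses, Introduction (chunk p0001 L10–L18) and §1 Criterion (2) (chunk p0003 L46–L70)]
[cite: VoisinHodgeI2002, Thm. 11.30] -/
theorem weilClassesField_le_algebraicClasses_of_mem_adjoin_of_comm (hA : 0 < A.dim)
    (hPm : P.Monic) (hPe : P.natDegree = e) (hPirr : Irreducible (P.map (Int.castRingHom ℚ)))
    (hφ : Polynomial.eval₂ (Int.castRingHom (CategoryTheory.End A)) (φ : CategoryTheory.End A) P = 0)
    (her : e * (2 * m) = 2 * A.dim) (hh : h ∈ hodgeClassSpan A.dim A.X 1)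
    (hnd : ∀ x : complexBetti A.X 1, (∀ y, polarizationPairingOne A.X h (A.dim - 1) x y = 0) → x = 0)
    (hS : ∀ S ∈ symmetricPullbackSpan A h, ∀ T ∈ symmetricPullbackSpan A h, S * T = T * S)
    (hF : pullbackOne A φ ∈ Algebra.adjoin ℂ (symmetricPullbackSpan A h : Set (Module.End ℂ (complexBetti A.X 1)))) :
    weilClassesField A φ P (2 * m) ≤ algebraicClasses A.X m :=
  (weilClassesField_le_divisorClassesSpan_of_mem_adjoin_of_comm hA hPm hPe hPirr hφ her hh hnd hS hF).trans
    (AbelianVariety.divisorClassesSpan_le_algebraicClasses A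
      (fun b hb hb' ↦ lefschetzOneOne_rational_holds (AbelianVariety.isSmoothProjective_holds (A := A)) b hb hb') m)

/-- **CRITERION (2) FOR COMMUTATIVE `B`: «`G_div(X)` acts as the identity on `W_F` if and only if `F ⊆ B`» AS AN
EQUIVALENCE WITH DECOMPOSABILITY** — for `0 < dim A`, `h` rational with `t • h` Kähler (`t ∈ ℝ ∖ 0`), `P` monic
irreducible of degree `e`, `P(φ) = 0`, `e · 2m = 2 dim A`, and `S_λ ⊗ ℂ` pairwise commuting:
`W_F ⊗ ℂ ≤ 𝒟ᵐ ⊗ ℂ ⟺ φ^* ∈ B ⊗ ℂ`. («⟹» is the seat's g17-#6, Lemma (3) `⊗ ℂ`; «⟸» is the previous theorem — for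
commutative `B` the condition «`G_div(X) ⊆ Sl_F(V_X)`» is automatic.)
[cite: MoonenZarhin1998WeilClasses, §1 Criterion (2) and its proof (chunk p0003 L46–L70), Lemma (3) (chunk p0003 L5)] -/
theorem weilClassesField_le_divisorClassesSpan_iff_mem_adjoin_of_comm (hA : 0 < A.dim)
    (hQ : IsRationalClass h) (ht : t ≠ 0) (hK : IsKaehlerClass A.dim A.X ((t : ℂ) • h))
    (hPm : P.Monic) (hPe : P.natDegree = e) (hPirr : Irreducible (P.map (Int.castRingHom ℚ)))
    (hφ : Polynomial.eval₂ (Int.castRingHom (CategoryTheory.End A)) (φ : CategoryTheory.End A) P = 0)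
    (her : e * (2 * m) = 2 * A.dim)
    (hS : ∀ S ∈ symmetricPullbackSpan A h, ∀ T ∈ symmetricPullbackSpan A h, S * T = T * S) :
    weilClassesField A φ P (2 * m) ≤ divisorClassesSpan A.X A.dim m ↔
      pullbackOne A φ ∈ Algebra.adjoin ℂ (symmetricPullbackSpan A h : Set (Module.End ℂ (complexBetti A.X 1))) :=
  ⟨pullbackOne_mem_adjoin_of_weilClassesField_le_divisorClassesSpan hA hQ ht hK hPm hPe hPirr hφ her,
    weilClassesField_le_divisorClassesSpan_of_mem_adjoin_of_comm hA hPm hPe hPirr hφ her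
      (mem_hodgeClassSpan_one_of_isKaehlerClass_smul hQ ht hK)
      (fun x hx ↦ eq_zero_of_forall_polarizationPairingOne_eq_zero_of_isKaehlerClass_smul' ht hK x hx) hS⟩

/-- **… ⟺ `φ` IS ROSATI-SYMMETRIC** (`φ† = φ`, read `Q_h(φ^* x, y) = Q_h(x, φ^* y)`): for commutative `B`, «`F ⊆ B`» is
«`F` pointwise `†`-fixed» (§1), so `W_F` is decomposable iff `φ^*` is `Q_h`-symmetric (hypotheses as above).
[cite: MoonenZarhin1998WeilClasses, §1 Criterion (2) and its proof (chunk p0003 L46–L70)] [cite: LangeBirkenhake1992, §5.1] -/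
theorem weilClassesField_le_divisorClassesSpan_iff_symm_of_comm (hA : 0 < A.dim)
    (hQ : IsRationalClass h) (ht : t ≠ 0) (hK : IsKaehlerClass A.dim A.X ((t : ℂ) • h))
    (hPm : P.Monic) (hPe : P.natDegree = e) (hPirr : Irreducible (P.map (Int.castRingHom ℚ)))
    (hφ : Polynomial.eval₂ (Int.castRingHom (CategoryTheory.End A)) (φ : CategoryTheory.End A) P = 0)
    (her : e * (2 * m) = 2 * A.dim)
    (hS : ∀ S ∈ symmetricPullbackSpan A h, ∀ T ∈ symmetricPullbackSpan A h, S * T = T * S) :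
    weilClassesField A φ P (2 * m) ≤ divisorClassesSpan A.X A.dim m ↔
      ∀ x y : complexBetti A.X 1, polarizationPairingOne A.X h (A.dim - 1) (pullbackOne A φ x) y =
        polarizationPairingOne A.X h (A.dim - 1) x (pullbackOne A φ y) := by
  rw [weilClassesField_le_divisorClassesSpan_iff_mem_adjoin_of_comm hA hQ ht hK hPm hPe hPirr hφ her hS]
  exact ⟨fun hF ↦ polarizationPairingOne_apply_eq_of_mem_adjoin_of_comm hS hF,
    fun hsym ↦ Algebra.subset_adjoin (pullbackOne_mem_symmetricPullbackSpan hsym)⟩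

/-- **THE EXCEPTIONAL ALTERNATIVE FOR COMMUTATIVE `B`: all non-zero Weil classes of `F` are exceptional ⟺ `φ† ≠ φ`**
(`m ≠ 0`; hypotheses as above): `W_F ⊗ ℂ ⊓ 𝒟ᵐ ⊗ ℂ = ⊥` iff `φ^*` is NOT `Q_h`-symmetric («or all non-zero classes in `W_F`
are exceptional; this last possibility occurs precisely [when] `F ⊄ B`» for `B` a field; `W_F ⊗ ℂ ≠ 0`).
[cite: MoonenZarhin1998WeilClasses, §1 Criterion (2) and its proof (chunk p0003 L46–L70)] -/
theorem weilClassesField_inf_divisorClassesSpan_eq_bot_iff_not_symm_of_comm (hA : 0 < A.dim)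
    (hQ : IsRationalClass h) (ht : t ≠ 0) (hK : IsKaehlerClass A.dim A.X ((t : ℂ) • h))
    (hPm : P.Monic) (hPe : P.natDegree = e) (hPirr : Irreducible (P.map (Int.castRingHom ℚ)))
    (hφ : Polynomial.eval₂ (Int.castRingHom (CategoryTheory.End A)) (φ : CategoryTheory.End A) P = 0)
    (her : e * (2 * m) = 2 * A.dim) (hm : m ≠ 0)
    (hS : ∀ S ∈ symmetricPullbackSpan A h, ∀ T ∈ symmetricPullbackSpan A h, S * T = T * S) :
    weilClassesField A φ P (2 * m) ⊓ divisorClassesSpan A.X A.dim m = ⊥ ↔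
      ¬ ∀ x y : complexBetti A.X 1, polarizationPairingOne A.X h (A.dim - 1) (pullbackOne A φ x) y =
        polarizationPairingOne A.X h (A.dim - 1) x (pullbackOne A φ y) := by
  rw [← weilClassesField_le_divisorClassesSpan_iff_symm_of_comm hA hQ ht hK hPm hPe hPirr hφ her hS]
  refine ⟨fun hbot hle ↦ ?_, fun hnot ↦ ?_⟩
  · obtain ⟨γ, hγW, -, hγ0⟩ := exists_isRationalClass_ne_zero_mem_weilClassesField hPm hPe hPirr hφ her
    have h0 : γ ∈ weilClassesField A φ P (2 * m) ⊓ divisorClassesSpan A.X A.dim m := ⟨hγW, hle hγW⟩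
    rw [hbot, Submodule.mem_bot] at h0
    exact hγ0 h0
  · rcases weilClassesField_inf_divisorClassesSpan_eq_bot_or_le hPe hPirr hφ her hm with hbot | hle
    · exact hbot
    · exact absurd hle hnot

/-- Witness form: for commutative `B`, ONE pair `x, y` with `Q_h(φ^* x, y) ≠ Q_h(x, φ^* y)` makes every non-zero class of
`W_F` exceptional (`m ≠ 0`). [cite: MoonenZarhin1998WeilClasses, §1 Criterion (2) (chunk p0003 L46–L58)] -/
theorem weilClassesField_inf_divisorClassesSpan_eq_bot_of_ne_of_comm (hA : 0 < A.dim)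
    (hQ : IsRationalClass h) (ht : t ≠ 0) (hK : IsKaehlerClass A.dim A.X ((t : ℂ) • h))
    (hPm : P.Monic) (hPe : P.natDegree = e) (hPirr : Irreducible (P.map (Int.castRingHom ℚ)))
    (hφ : Polynomial.eval₂ (Int.castRingHom (CategoryTheory.End A)) (φ : CategoryTheory.End A) P = 0)
    (her : e * (2 * m) = 2 * A.dim) (hm : m ≠ 0)
    (hS : ∀ S ∈ symmetricPullbackSpan A h, ∀ T ∈ symmetricPullbackSpan A h, S * T = T * S)
    {x y : complexBetti A.X 1} (hne : polarizationPairingOne A.X h (A.dim - 1) (pullbackOne A φ x) y ≠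
      polarizationPairingOne A.X h (A.dim - 1) x (pullbackOne A φ y)) :
    weilClassesField A φ P (2 * m) ⊓ divisorClassesSpan A.X A.dim m = ⊥ :=
  (weilClassesField_inf_divisorClassesSpan_eq_bot_iff_not_symm_of_comm hA hQ ht hK hPm hPe hPirr hφ her hm hS).2
    fun hsym ↦ hne (hsym x y)

/-! ### §4 `End(A)` commutative: decomposable ⟺ Rosati-symmetric, for every subfield `F = ℚ(φ)` -/

/-- **`End(A)` COMMUTATIVE ⟹ for every `F = ℚ(φ) ⊆ End⁰(A)`: `W_F` decomposable ⟺ `φ` Rosati-symmetric** (`0 < dim A`;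
`h` rational with `t • h` Kähler, `t ∈ ℝ ∖ 0`; `P` monic irreducible of degree `e`, `P(φ) = 0`, `e · 2m = 2 dim A`) — the
rows «type 1, `m = 1`» (`End⁰(Y) = E` totally real: `†` trivial, EVERY `W_F` decomposable) and «Type 4, `d = 1`, `m = 1`»
(`End⁰(Y) = E` a CM field: `†` = complex conjugation, decomposable iff `F ⊆ E₀`) of Criterion (2), with «`Y` simple of
that type» replaced by the carrier hypothesis `f ≫ g = g ≫ f` on `End(A)`.
[cite: MoonenZarhin1998WeilClasses, §1 Criterion (2) and its proof (chunk p0003 L46–L70), Table 1 (chunk p0002 L59–L62)]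
[cite: Milne1999LefschetzClasses, p. 645] -/
theorem weilClassesField_le_divisorClassesSpan_iff_symm_of_forall_comp_comm (hA : 0 < A.dim)
    (hE : ∀ f g : A ⟶ A, f ≫ g = g ≫ f)
    (hQ : IsRationalClass h) (ht : t ≠ 0) (hK : IsKaehlerClass A.dim A.X ((t : ℂ) • h))
    (hPm : P.Monic) (hPe : P.natDegree = e) (hPirr : Irreducible (P.map (Int.castRingHom ℚ)))
    (hφ : Polynomial.eval₂ (Int.castRingHom (CategoryTheory.End A)) (φ : CategoryTheory.End A) P = 0)
    (her : e * (2 * m) = 2 * A.dim) :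
    weilClassesField A φ P (2 * m) ≤ divisorClassesSpan A.X A.dim m ↔
      ∀ x y : complexBetti A.X 1, polarizationPairingOne A.X h (A.dim - 1) (pullbackOne A φ x) y =
        polarizationPairingOne A.X h (A.dim - 1) x (pullbackOne A φ y) :=
  weilClassesField_le_divisorClassesSpan_iff_symm_of_comm hA hQ ht hK hPm hPe hPirr hφ her
    (symmetricPullbackSpan_comm_of_forall_comp_comm hE)

/-- **`End(A)` COMMUTATIVE ⟹ all non-zero Weil classes of `F = ℚ(φ)` are exceptional ⟺ `φ` is NOT Rosati-symmetric**
(`m ≠ 0`; hypotheses as above). [cite: MoonenZarhin1998WeilClasses, §1 Criterion (2) and its proof (chunk p0003 L46–L70)] -/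
theorem weilClassesField_inf_divisorClassesSpan_eq_bot_iff_not_symm_of_forall_comp_comm (hA : 0 < A.dim)
    (hE : ∀ f g : A ⟶ A, f ≫ g = g ≫ f)
    (hQ : IsRationalClass h) (ht : t ≠ 0) (hK : IsKaehlerClass A.dim A.X ((t : ℂ) • h))
    (hPm : P.Monic) (hPe : P.natDegree = e) (hPirr : Irreducible (P.map (Int.castRingHom ℚ)))
    (hφ : Polynomial.eval₂ (Int.castRingHom (CategoryTheory.End A)) (φ : CategoryTheory.End A) P = 0)
    (her : e * (2 * m) = 2 * A.dim) (hm : m ≠ 0) :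
    weilClassesField A φ P (2 * m) ⊓ divisorClassesSpan A.X A.dim m = ⊥ ↔
      ¬ ∀ x y : complexBetti A.X 1, polarizationPairingOne A.X h (A.dim - 1) (pullbackOne A φ x) y =
        polarizationPairingOne A.X h (A.dim - 1) x (pullbackOne A φ y) :=
  weilClassesField_inf_divisorClassesSpan_eq_bot_iff_not_symm_of_comm hA hQ ht hK hPm hPe hPirr hφ her hm
    (symmetricPullbackSpan_comm_of_forall_comp_comm hE)

/-! ### §6 (rider) The STANDARD-INVOLUTION hypothesis «`x + x†` central»: `S_λ` is central, `B` is commutative, and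
«`F ⊄ E` ⟹ all non-zero Weil classes exceptional» — the row «`Y` of Type 3, `m = 1`» read on the carrier -/

/-- **A standard Rosati involution makes `S_λ ⊗ ℂ` CENTRAL**: if for every `ℂ`-combination `T` of pull-backs and every
`Q_h`-adjoint `T'` of it the sum `T + T'` commutes with all pull-backs («`x + x† ∈ E`», as for the canonical involution
`x ↦ x̄` of a totally definite quaternion algebra — the Rosati involution of type III, Mumford §21 Thm. 2 / Lange–Birkenhake
Thm. 5.5.6 — and trivially for a commutative `End⁰(X)`), then every `s ∈ S_λ ⊗ ℂ` commutes with every pull-back (`s` is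
its own adjoint, so `2s` is central). [cite: MoonenZarhin1998WeilClasses, §1 (S_λ, B, Table 1: «B = E» for type 3 with m = 1; chunk p0002 L54–L62)]
[cite: LangeBirkenhake1992, Thm. 5.5.6] -/
theorem symmetricPullbackSpan_comm_pullbackOne_of_forall_add_adjoint
    (hstd : ∀ T ∈ Submodule.span ℂ (Set.range fun ψ : A ⟶ A ↦ pullbackOne A ψ), ∀ T' : Module.End ℂ (complexBetti A.X 1),
      (∀ x y : complexBetti A.X 1, polarizationPairingOne A.X h (A.dim - 1) (T x) y =
        polarizationPairingOne A.X h (A.dim - 1) x (T' y)) →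
      ∀ ψ : A ⟶ A, (T + T') * pullbackOne A ψ = pullbackOne A ψ * (T + T'))
    (hS0 : S ∈ symmetricPullbackSpan A h) (ψ : A ⟶ A) : S * pullbackOne A ψ = pullbackOne A ψ * S := by
  have h2 := hstd S hS0.1 S hS0.2 ψ
  rw [← two_smul ℂ S, smul_mul_assoc, mul_smul_comm] at h2
  exact smul_right_injective _ (two_ne_zero (α := ℂ)) h2

/-- **… hence `S_λ ⊗ ℂ` is pairwise commuting** (each `s ∈ S_λ ⊗ ℂ` commutes with the pull-backs, so with their
`ℂ`-combinations, among which the elements of `S_λ ⊗ ℂ`): the standard-involution hypothesis implies the commutativity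
hypothesis of §§1–4, and `B ⊗ ℂ = S_λ ⊗ ℂ` is a commutative algebra of central elements («`B = E`»).
[cite: MoonenZarhin1998WeilClasses, §1 (chunk p0002 L54–L62)] -/
theorem symmetricPullbackSpan_comm_of_forall_add_adjoint
    (hstd : ∀ T ∈ Submodule.span ℂ (Set.range fun ψ : A ⟶ A ↦ pullbackOne A ψ), ∀ T' : Module.End ℂ (complexBetti A.X 1),
      (∀ x y : complexBetti A.X 1, polarizationPairingOne A.X h (A.dim - 1) (T x) y =
        polarizationPairingOne A.X h (A.dim - 1) x (T' y)) →
      ∀ ψ : A ⟶ A, (T + T') * pullbackOne A ψ = pullbackOne A ψ * (T + T')) :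
    ∀ S ∈ symmetricPullbackSpan A h, ∀ T ∈ symmetricPullbackSpan A h, S * T = T * S := by
  intro S hS0 T hT0
  -- `S` commutes with every `ℂ`-combination of pull-backs
  suffices H : ∀ T ∈ Submodule.span ℂ (Set.range fun ψ : A ⟶ A ↦ pullbackOne A ψ), S * T = T * S from H T hT0.1
  intro T hT
  induction hT using Submodule.span_induction with
  | mem T hT =>
    obtain ⟨ψ, rfl⟩ := hT
    exact symmetricPullbackSpan_comm_pullbackOne_of_forall_add_adjoint hstd hS0 ψ
  | zero => rw [mul_zero, zero_mul]
  | add T T' _ _ h1 h2 => rw [mul_add, add_mul, h1, h2]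
  | smul r T _ h1 => rw [mul_smul_comm, smul_mul_assoc, h1]

/-- **«`Y` of Type 3, `m = 1` and `F ⊄ E` ⟹ all non-zero classes in `W_F` are exceptional», ON THE CARRIER**: under the
standard-involution hypothesis («`x + x†` central», `E` = the centre of `End⁰(X)`), if `φ^*` does NOT commute with some
pull-back `ψ^*` («`F ⊄ E`») then `W_F ⊗ ℂ ⊓ 𝒟ᵐ ⊗ ℂ = ⊥` (`0 < dim A`, `h` rational with `t • h` Kähler, `t ∈ ℝ ∖ 0`, `P`
monic irreducible of degree `e`, `P(φ) = 0`, `e · 2m = 2 dim A`, `m ≠ 0`): a non-central `φ^*` is not symmetric (symmetric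
elements are central), and §3 applies. [cite: MoonenZarhin1998WeilClasses, §1 Criterion (2) («Y is of Type 3, m = 1 and F ⊄ E»; chunk p0003 L46–L70)]
[cite: LangeBirkenhake1992, Thm. 5.5.6] -/
theorem weilClassesField_inf_divisorClassesSpan_eq_bot_of_not_comm_of_forall_add_adjoint (hA : 0 < A.dim)
    (hQ : IsRationalClass h) (ht : t ≠ 0) (hK : IsKaehlerClass A.dim A.X ((t : ℂ) • h))
    (hPm : P.Monic) (hPe : P.natDegree = e) (hPirr : Irreducible (P.map (Int.castRingHom ℚ)))
    (hφ : Polynomial.eval₂ (Int.castRingHom (CategoryTheory.End A)) (φ : CategoryTheory.End A) P = 0)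
    (her : e * (2 * m) = 2 * A.dim) (hm : m ≠ 0)
    (hstd : ∀ T ∈ Submodule.span ℂ (Set.range fun ψ : A ⟶ A ↦ pullbackOne A ψ), ∀ T' : Module.End ℂ (complexBetti A.X 1),
      (∀ x y : complexBetti A.X 1, polarizationPairingOne A.X h (A.dim - 1) (T x) y =
        polarizationPairingOne A.X h (A.dim - 1) x (T' y)) →
      ∀ ψ : A ⟶ A, (T + T') * pullbackOne A ψ = pullbackOne A ψ * (T + T'))
    {ψ : A ⟶ A} (hne : pullbackOne A φ * pullbackOne A ψ ≠ pullbackOne A ψ * pullbackOne A φ) :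
    weilClassesField A φ P (2 * m) ⊓ divisorClassesSpan A.X A.dim m = ⊥ :=
  (weilClassesField_inf_divisorClassesSpan_eq_bot_iff_not_symm_of_comm hA hQ ht hK hPm hPe hPirr hφ her hm
    (symmetricPullbackSpan_comm_of_forall_add_adjoint hstd)).2 fun hsym ↦
      hne (symmetricPullbackSpan_comm_pullbackOne_of_forall_add_adjoint hstd (pullbackOne_mem_symmetricPullbackSpan hsym) ψ)

/-- **… and «`F ⊆ E`», i.e. `φ^*` central, with `†` trivial on the centre ⟹ `W_F` decomposable**: under the
standard-involution hypothesis, if `φ^*` is `Q_h`-symmetric — for a type-III-like algebra whose involution fixes the centre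
this is «`φ ∈ E`» — then `W_F ⊗ ℂ ≤ 𝒟ᵐ ⊗ ℂ`; the equivalence «decomposable ⟺ `φ† = φ`» is §3's
`weilClassesField_le_divisorClassesSpan_iff_symm_of_comm` with the commutativity supplied by `hstd`.
[cite: MoonenZarhin1998WeilClasses, §1 Criterion (2) and its proof (chunk p0003 L46–L70)] -/
theorem weilClassesField_le_divisorClassesSpan_iff_symm_of_forall_add_adjoint (hA : 0 < A.dim)
    (hQ : IsRationalClass h) (ht : t ≠ 0) (hK : IsKaehlerClass A.dim A.X ((t : ℂ) • h))
    (hPm : P.Monic) (hPe : P.natDegree = e) (hPirr : Irreducible (P.map (Int.castRingHom ℚ)))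
    (hφ : Polynomial.eval₂ (Int.castRingHom (CategoryTheory.End A)) (φ : CategoryTheory.End A) P = 0)
    (her : e * (2 * m) = 2 * A.dim)
    (hstd : ∀ T ∈ Submodule.span ℂ (Set.range fun ψ : A ⟶ A ↦ pullbackOne A ψ), ∀ T' : Module.End ℂ (complexBetti A.X 1),
      (∀ x y : complexBetti A.X 1, polarizationPairingOne A.X h (A.dim - 1) (T x) y =
        polarizationPairingOne A.X h (A.dim - 1) x (T' y)) →
      ∀ ψ : A ⟶ A, (T + T') * pullbackOne A ψ = pullbackOne A ψ * (T + T')) :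
    weilClassesField A φ P (2 * m) ≤ divisorClassesSpan A.X A.dim m ↔
      ∀ x y : complexBetti A.X 1, polarizationPairingOne A.X h (A.dim - 1) (pullbackOne A φ x) y =
        polarizationPairingOne A.X h (A.dim - 1) x (pullbackOne A φ y) :=
  weilClassesField_le_divisorClassesSpan_iff_symm_of_comm hA hQ ht hK hPm hPe hPirr hφ her
    (symmetricPullbackSpan_comm_of_forall_add_adjoint hstd)

end HodgeTheory

/-! ### §5 The CM row: «`Y` of Type 4, `d = 1`, `m = 1`: exceptional iff `F ⊄ E₀`» for a simple CM abelian variety -/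

section CM

open Literature.AlgebraicGeometry.ComplexMultiplication

variable {K : Type} [Field K] [NumberField K] [IsCMField K] {Φ : CMType K} {A : AbelianVariety ℂ}
  {ιA : 𝓞 K →+* CategoryTheory.End A} {θ : K →+* Module.End ℂ (complexBetti A.X 1)}
  {P : Polynomial ℤ} {e m : ℕ}

omit [IsCMField K] in
/-- A CM-type realisation has positive dimension (`dim_ℂ H¹ = [K:ℚ] ≥ 1`). [folklore] -/
private theorem dim_pos_of_isCMTypeRealisation (hR : IsCMTypeRealisation Φ A ιA θ) : 0 < A.dim := by
  have h1 : Module.finrank ℂ (complexBetti A.X 1) = 2 * A.dim := AbelianVariety.finrank_complexBetti_one A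
  have h2 : 0 < Module.finrank ℚ K := Module.finrank_pos
  rw [hR.2.1] at h1
  omega

/-- **For `End(A)` commutative and a Rosati class `h` of the CM structure, `ι(a)^*` is `Q_h`-symmetric iff `ā = a`**
(`Q_h(ι(a)^* x, y) = Q_h(x, ι(ā)^* y)`, Shimura §6.2 Thm. 4 (3) of the tree; `Q_h` non-degenerate; `θ` injective).
[cite: Shimura1998, §6.2 Theorem 4 (3)] [cite: Milne1999LefschetzClasses, p. 645] -/
theorem forall_polarizationPairingOne_apply_eq_iff_conj_eq_of_isCMTypeRealisation (hR : IsCMTypeRealisation Φ A ιA θ)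
    {h : complexBetti A.X 2}
    (hnd : ∀ x : complexBetti A.X 1, (∀ y, polarizationPairingOne A.X h (A.dim - 1) x y = 0) → x = 0)
    (hros : ∀ (a ac : 𝓞 K), (ac : K) = IsCMField.complexConj K (a : K) → ∀ x y : complexBetti A.X 1,
      polarizationPairingOne A.X h (A.dim - 1) (complexBetti.map (ιA a).hom.hom.hom 1 x) y =
        polarizationPairingOne A.X h (A.dim - 1) x (complexBetti.map (ιA ac).hom.hom.hom 1 y))
    (a : 𝓞 K) :
    (∀ x y : complexBetti A.X 1, polarizationPairingOne A.X h (A.dim - 1) (pullbackOne A (ιA a) x) y =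
        polarizationPairingOne A.X h (A.dim - 1) x (pullbackOne A (ιA a) y)) ↔
      IsCMField.complexConj K (a : K) = a := by
  have hros' : ∀ x y : complexBetti A.X 1, polarizationPairingOne A.X h (A.dim - 1) (pullbackOne A (ιA a) x) y =
      polarizationPairingOne A.X h (A.dim - 1) x (pullbackOne A (ιA (IsCMField.ringOfIntegersComplexConj K a)) y) :=
    hros a (IsCMField.ringOfIntegersComplexConj K a) (IsCMField.coe_ringOfIntegersComplexConj K a)
  have hθ : ∀ b : 𝓞 K, pullbackOne A (ιA b) = θ (b : K) := fun b ↦ hR.2.2.1 b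
  constructor
  · intro hsym
    -- `ι(ā)^* = ι(a)^*` by non-degeneracy, then `θ` is injective
    have heq : pullbackOne A (ιA (IsCMField.ringOfIntegersComplexConj K a)) = pullbackOne A (ιA a) := by
      refine LinearMap.ext fun y ↦ ?_
      rw [← sub_eq_zero, ← LinearMap.sub_apply]
      refine hnd _ fun x ↦ ?_
      rw [LinearMap.sub_apply, map_sub, LinearMap.sub_apply,
        polarizationPairingOne_swap h (A.dim - 1) x (pullbackOne A (ιA (IsCMField.ringOfIntegersComplexConj K a)) y),
        ← hros' x y, hsym x y, ← polarizationPairingOne_swap h (A.dim - 1) x (pullbackOne A (ιA a) y), sub_self]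
    rw [hθ, hθ, IsCMField.coe_ringOfIntegersComplexConj] at heq
    have h1 : Module.finrank ℂ (complexBetti A.X 1) = 2 * A.dim := AbelianVariety.finrank_complexBetti_one A
    have hpos : 0 < Module.finrank ℂ (complexBetti A.X 1) := by
      rw [h1]; have := dim_pos_of_isCMTypeRealisation hR; omega
    haveI : Nontrivial (complexBetti A.X 1) := Module.nontrivial_of_finrank_pos hpos
    exact θ.injective heq
  · intro ha x y
    rw [hros' x y, hθ, IsCMField.coe_ringOfIntegersComplexConj, ha, ← hθ]

/-- **MOONEN–ZARHIN, CRITERION (2), THE ROW «`Y` OF TYPE 4, `d = 1`, `m = 1`», PROVED for a simple CM abelian variety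
read on the carrier**: let `(A, ι, θ)` be a realisation of a CM type `(K; Φ)` (`ComplexMultiplication.IsCMTypeRealisation`)
with `End(A)` commutative (`f ≫ g = g ≫ f` — for a CM-type realisation by the field `K` this says `End⁰(A) = K`, `A`
simple), and `a ∈ 𝓞_K` with `P(ι a) = 0`, `P ∈ ℤ[T]` monic irreducible of degree `e` (so `F = ℚ(a)` has degree `e`),
`e · 2m = 2 dim A`. Then `W_F ⊗ ℂ ≤ 𝒟ᵐ ⊗ ℂ` — THE WEIL CLASSES RELATIVE TO `F = ℚ(a)` ARE DECOMPOSABLE — **iff `ā = a`**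
(iff `F ⊆ K⁺ = E₀`). Road: Shimura's Rosati class `h` of the tree (`IsCMTypeRealisation.exists_rosati_kaehlerClass`:
rational, a real multiple of a Kähler class, `ι(b)† = ι(b̄)`), §4 («decomposable ⟺ `ι(a)† = ι(a)`»), and
`ι(a)† = ι(a) ⟺ ā = a`. [cite: MoonenZarhin1998WeilClasses, §1 Criterion (2) («Y is of Type 4, d = 1, m = 1 and F ⊄ E₀»; chunk p0003 L46–L70)]
[cite: Shimura1998, §6.2 Theorem 4 (3)] [cite: Milne1999LefschetzClasses, p. 645] -/
theorem weilClassesField_le_divisorClassesSpan_iff_conj_eq_of_isCMTypeRealisation (hR : IsCMTypeRealisation Φ A ιA θ)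
    (hE : ∀ f g : A ⟶ A, f ≫ g = g ≫ f) {a : 𝓞 K}
    (hPm : P.Monic) (hPe : P.natDegree = e) (hPirr : Irreducible (P.map (Int.castRingHom ℚ)))
    (hφ : Polynomial.eval₂ (Int.castRingHom (CategoryTheory.End A)) (ιA a) P = 0) (her : e * (2 * m) = 2 * A.dim) :
    weilClassesField A (ιA a) P (2 * m) ≤ divisorClassesSpan A.X A.dim m ↔ IsCMField.complexConj K (a : K) = a := by
  obtain ⟨h, hQ, -, ⟨t, ht, hK⟩, hros⟩ := hR.exists_rosati_kaehlerClass
  rw [weilClassesField_le_divisorClassesSpan_iff_symm_of_forall_comp_comm (dim_pos_of_isCMTypeRealisation hR) hE hQ ht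
    hK hPm hPe hPirr hφ her]
  exact forall_polarizationPairingOne_apply_eq_iff_conj_eq_of_isCMTypeRealisation hR
    (fun x hx ↦ eq_zero_of_forall_polarizationPairingOne_eq_zero_of_isKaehlerClass_smul' ht hK x hx) hros a

/-- **… and «all non-zero classes in `W_F` are exceptional precisely [when] `F ⊄ E₀`»**: under the same hypotheses and
`m ≠ 0`, `W_F ⊗ ℂ ⊓ 𝒟ᵐ ⊗ ℂ = ⊥` iff `ā ≠ a` — no non-zero Weil class relative to `F = ℚ(a)` with `a ∉ K⁺` is a
`ℂ`-combination of products of divisor classes. [cite: MoonenZarhin1998WeilClasses, §1 Criterion (2) («Y is of Type 4, d = 1, m = 1 and F ⊄ E₀»; chunk p0003 L46–L70)]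
[cite: Shimura1998, §6.2 Theorem 4 (3)] -/
theorem weilClassesField_inf_divisorClassesSpan_eq_bot_iff_conj_ne_of_isCMTypeRealisation
    (hR : IsCMTypeRealisation Φ A ιA θ) (hE : ∀ f g : A ⟶ A, f ≫ g = g ≫ f) {a : 𝓞 K}
    (hPm : P.Monic) (hPe : P.natDegree = e) (hPirr : Irreducible (P.map (Int.castRingHom ℚ)))
    (hφ : Polynomial.eval₂ (Int.castRingHom (CategoryTheory.End A)) (ιA a) P = 0) (her : e * (2 * m) = 2 * A.dim)
    (hm : m ≠ 0) :
    weilClassesField A (ιA a) P (2 * m) ⊓ divisorClassesSpan A.X A.dim m = ⊥ ↔ IsCMField.complexConj K (a : K) ≠ a := by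
  obtain ⟨h, hQ, -, ⟨t, ht, hK⟩, hros⟩ := hR.exists_rosati_kaehlerClass
  rw [weilClassesField_inf_divisorClassesSpan_eq_bot_iff_not_symm_of_forall_comp_comm (dim_pos_of_isCMTypeRealisation hR)
    hE hQ ht hK hPm hPe hPirr hφ her hm, forall_polarizationPairingOne_apply_eq_iff_conj_eq_of_isCMTypeRealisation hR
    (fun x hx ↦ eq_zero_of_forall_polarizationPairingOne_eq_zero_of_isKaehlerClass_smul' ht hK x hx) hros a]

/-- **… so for `a ∈ K⁺` (`ā = a`) the Weil classes relative to `ℚ(a)` are ALGEBRAIC** on such an `A` (decomposable, then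
Lefschetz `(1,1)`). [cite: MoonenZarhin1998WeilClasses, Introduction (chunk p0001 L10–L18) and §1 Criterion (2) (chunk p0003 L46–L70)]
[cite: VoisinHodgeI2002, Thm. 11.30] -/
theorem weilClassesField_le_algebraicClasses_of_conj_eq_of_isCMTypeRealisation (hR : IsCMTypeRealisation Φ A ιA θ)
    (hE : ∀ f g : A ⟶ A, f ≫ g = g ≫ f) {a : 𝓞 K}
    (hPm : P.Monic) (hPe : P.natDegree = e) (hPirr : Irreducible (P.map (Int.castRingHom ℚ)))
    (hφ : Polynomial.eval₂ (Int.castRingHom (CategoryTheory.End A)) (ιA a) P = 0) (her : e * (2 * m) = 2 * A.dim)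
    (ha : IsCMField.complexConj K (a : K) = a) :
    weilClassesField A (ιA a) P (2 * m) ≤ algebraicClasses A.X m :=
  ((weilClassesField_le_divisorClassesSpan_iff_conj_eq_of_isCMTypeRealisation hR hE hPm hPe hPirr hφ her).2 ha).trans
    (AbelianVariety.divisorClassesSpan_le_algebraicClasses A
      (fun b hb hb' ↦ lefschetzOneOne_rational_holds (AbelianVariety.isSmoothProjective_holds (A := A)) b hb hb') m)

end CM

end Literature.AlgebraicGeometry.HodgeTheory

end
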